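import Literature.MathematicalPhysics.QuantumFieldTheory.Balaban1983to89.B9Eq319QprimeTowerFlatSection
import Literature.MathematicalPhysics.QuantumFieldTheory.Balaban1983to89.B9Eq319BumpProfileCos

/-!
# `Balaban1983to89.B9Eq319BumpSectionLaplacianFlat` — T. Bałaban, *Propagators for lattice gauge theories in a background field*, Commun. Math. Phys.
# **99** (1985) 389–434 [Balaban1985BackgroundPropagators] (3.19) p. 393, (3.23) p. 394, Cor. 3.6 p. 408 with (3.87)–(3.89) p. 409: **THE LAPLACIAN LETTER
# OF A BUMP SECTION OF THE FLAT AVERAGING `Q′(1)` — for a block profile `φ` vanishing at both ends of every block-crossing bond and with second differences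
# `≤ ℓ₂`, the section `Ψg(x) = φ(x)·g(ȳ(x))` has `‖Δ(1)(Ψg)‖ ≤ ‖c‖²·dℓ₂·√(c₀L^d∕c₁)·‖g‖`; with the cosine bump of `B9Eq319BumpProfileCos` on print's diagonal
# (`c = η⁻¹`, `Lη = 1`, `c₁ = c₀L^d`) this is `≤ d(3∕2)^d·9π²·2^{d−1}·‖g‖` — NO `η`, NO `L`, NO volume** (the letter `hCΨ : ‖Δ_s(Ψg)‖ ≤ C_Ψ‖g‖` of
# `B9Eq387CubeLocalisedProjection.norm_sub_projR_cube_le(_weighted)` INHABITED AT THE FLAT BACKGROUND)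

statement-level skeleton of published theorems with citation tags; proofs where landed; nothing here is a claim about the Yang–Mills mass gap

CITATION HEADER (lean-in-tree rule).  Audit cell `pub-balaban`, sub-cell `t4`, BINDER row NE9; filed by NE9 formalisation-swarm LEAF PROVER 05
(`b2b-balaban-t4-ne9-formalise-leaf-05`, gen 75), route R2′ STEP B8′ S-P6′(β) (ROUTES-NE9 §L1.2; t4-ne9-idea-1 g100 W-(P-CΨ)): the (β) four-term bound
`B9Eq387CubeLocalisedProjection.norm_sub_projR_cube_le_weighted` displays a section `Ψ` of the gauge-parameter averaging with `Q′Ψ = 1` and the LAPLACIAN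
letter `‖Δ_s(Ψg)‖ ≤ C_Ψ‖g‖`; this lineage's located count (journal W-7, 2026-08-23) is that `C_Ψ` is `η`-free exactly when the profile has `O(L⁻²)` SECOND
differences (the cosine bump `B9Eq319BumpProfileCos`, not the tent `B9Eq319BumpProfile`) AND the transport part is read in print's (3.35) gauge; this file is
the FLAT-background half (no transport), where the count is a theorem.  Sources READ: [Balaban1985BackgroundPropagators] p. 393 (3.19), p. 394 (3.23)
`Δ^η_U = D*_UD_U`, p. 408 Cor. 3.6, p. 409 (3.87)–(3.89) (the cube-localised comparison whose section letter this is).  A bump section is the CHAIN's device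
(ROUTES-NE9 kernels 5∕6), NOT print's (random-walk expansions); NOTHING of print's estimates is asserted.

WHAT IS PROVED (sorry-free; proof lane — no `def`; the section enters through the POINTWISE letter `hΨ : (Ψg)(x) = φ(x)·g(ȳ(x))`, an existence clause
packages it; [folklore] discrete Leibniz at a block-constant factor + finite sums).
* §1 `smul_apply_shift_eq` ∕ `smul_apply_unshift_eq` — a profile vanishing at both ends of block-crossing bonds freezes the block index: `φ(x ± e_μ)·g(ȳ(x ± e_μ))
  = φ(x ± e_μ)·g(ȳ(x))`.
* §2 **`equiv_covLaplaceSiteK_flat`** — the flat (3.23) pointwise: `(Δ(1)f)(x) = c²·Σ_μ ((f(x) − f(x − e_μ)) − (f(x + e_μ) − f(x)))` for transporters acting as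
  the identity (letters `hR`, `hS`).
* §3 **`equiv_covLaplaceSiteK_section`** (`(Δ(1)Ψg)(x) = c²·(Σ_μ Δ²_μφ(x))·g(ȳ(x))`), **`norm_equiv_covLaplaceSiteK_section_le`** (`≤ ‖c‖²·dℓ₂·‖g(ȳ(x))‖`).
* §4 **`norm_covLaplaceSiteK_section_le`** — `‖Δ(1)(Ψg)‖_{L²(c₀)} ≤ ‖c‖²·dℓ₂·√(c₀L^d∕c₁)·‖g‖_{L²(c₁)}` (`Σ_x‖g(ȳ(x))‖² = L^dΣ_y‖g(y)‖²`).
* §5 **`QprimeW_one_section`** — `Q′(1)(Ψg) = g` from the profile's block mean `Σ_{B(y)} L^{−d}φ = 1`.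
* §6 **`norm_covLaplaceSiteK_section_le_diagonal`** — with the cosine-bump letter `ℓ₂ = (L∕(L−1))^d(2π∕(L−1))²2^{d−1}`, `L ≥ 3`, `c = η⁻¹`, `Lη = 1`,
  `c₁ = c₀L^d`: `‖Δ(1)(Ψg)‖ ≤ d(3∕2)^d·9π²·2^{d−1}·‖g‖`.
* §7 **`exists_flat_bump_section`** — the package: `∃ Ψ` linear with `Q′(1)Ψ = 1` and the §6 bound (the cosine bump inside).
HONEST SCOPE.  FLAT background only (`U = 1`: no transport terms — at a background `U` in print's (3.35) gauge two more letters enter, the adjacent-parallel-bond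
window `|∇^ηA|η²` and the bond window `αη`; NOT done here); no cut-off `θ`, no weights, no minimiser — ONE letter of ONE sub-step of a route step, NOT NE9
(cell pub-balaban: NE9 NOT PRINTED ∕ NOT PROVED; «NE9 ⇐ the named binders»; row WALLED ON A MODEL (O-NE9-1; #5 UNRULED); spine PROVED 0∕9; rung (B)+1 on a
finite T⁴ — NOT infinite volume, NOT mass gap, NOT BetaPertH, NOT Clay; HONEST DEPENDENCY: continuum YM on T⁴ ⇐ BetaPertH ∧ nine spine estimates (0/9
proved); BetaPertH ⇐ (D1) ∧ (D4) ∧ CAP+tail; G-an2-4 gates asym, D1 and NE2/3/4).  NEW file; imports `B9Eq319QprimeTowerFlatSection` + `B9Eq319BumpProfileCos`;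
nothing modified.  Net new unproved facts: 0.
-/

noncomputable section

open scoped InnerProductSpace BigOperators

namespace Literature.MathematicalPhysics.QuantumFieldTheory.Balaban1983to89.B9Eq319BumpSectionLaplacianFlat

open B4Sect5Torus (TSite)
open B9SectCLatticeCarrier (Bond bpos btgt shift unshift shift_unshift)
open B9Eq311L2Pairing (WL2)
open B11Eq103H1Complex (SiteL2K covLaplaceSiteK covDerivL2K covDivL2K equiv_covDerivL2K equiv_covDivL2K)
open B9Eq33CovDerivVector (covDeriv covDiv covDeriv_apply_dir covDiv_apply)
open B9Eq319QprimeTorus (fineP blockCoord mem_blockOf_iff)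
open B9Eq319QprimeLipschitz (QprimeW_one_apply)
open B9Eq326OperatorAssembly (QprimeW)
open B9Eq319QprimeTowerFlatSection (sum_norm_sq_comp_blockCoord)
open B9Eq319BumpProfileCos (exists_bumpProfileCos bumpProfileCos_const_le)

variable {d : ℕ} (L : ℕ) [NeZero L] (m : Fin d → ℕ)
  {W : Type*} [NormedAddCommGroup W] [InnerProductSpace ℂ W]

/-! ## §1 A profile vanishing across block faces freezes the block index -/

section Freeze

variable {φ : TSite d (fineP L m) → ℝ}
  (hcross : ∀ b : Bond d (fineP L m), blockCoord L m (btgt b) ≠ blockCoord L m (bpos b) → φ (bpos b) = 0 ∧ φ (btgt b) = 0)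

include hcross

omit [NeZero L] in
/-- `φ(x + e_μ)·g(ȳ(x + e_μ)) = φ(x + e_μ)·g(ȳ(x))`: either the bond `(x, μ)` stays in the block, or `φ(x + e_μ) = 0`. [folklore]
[cite: Balaban1985BackgroundPropagators, (3.19) p.393] -/
theorem smul_apply_shift_eq (g : TSite d m → W) (x : TSite d (fineP L m)) (μ : Fin d) :
    ((φ (shift μ x) : ℝ) : ℂ) • g (blockCoord L m (shift μ x)) = ((φ (shift μ x) : ℝ) : ℂ) • g (blockCoord L m x) := by
  by_cases h : blockCoord L m (shift μ x) = blockCoord L m x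
  · rw [h]
  · have h0 : φ (shift μ x) = 0 := (hcross (x, μ) h).2
    rw [h0, Complex.ofReal_zero, zero_smul, zero_smul]

omit [NeZero L] in
/-- `φ(x − e_μ)·g(ȳ(x − e_μ)) = φ(x − e_μ)·g(ȳ(x))`: the bond `(x − e_μ, μ)` has target `x`. [folklore] [cite: Balaban1985BackgroundPropagators, (3.19) p.393] -/
theorem smul_apply_unshift_eq (g : TSite d m → W) (x : TSite d (fineP L m)) (μ : Fin d) :
    ((φ (unshift μ x) : ℝ) : ℂ) • g (blockCoord L m (unshift μ x)) = ((φ (unshift μ x) : ℝ) : ℂ) • g (blockCoord L m x) := by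
  by_cases h : blockCoord L m (unshift μ x) = blockCoord L m x
  · rw [h]
  · have hb : blockCoord L m (btgt ((unshift μ x, μ) : Bond d (fineP L m))) ≠ blockCoord L m (bpos ((unshift μ x, μ) : Bond d (fineP L m))) := by
      simp only [btgt, bpos, shift_unshift]
      exact fun e => h e.symm
    have h0 : φ (unshift μ x) = 0 := (hcross _ hb).1
    rw [h0, Complex.ofReal_zero, zero_smul, zero_smul]

end Freeze

/-! ## §2 The flat covariant Laplacian, pointwise -/

section Flat

variable {Pd : Fin d → ℕ} {c₀ : ℝ} [Fact (0 < c₀)]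

omit [NeZero L] in
/-- **THE FLAT (3.23) POINTWISE**: for transporters acting as the identity, `(Δ(1)f)(x) = c²·Σ_μ ((f(x) − f(x − e_μ)) − (f(x + e_μ) − f(x)))` — minus the
second difference, times `c² = η⁻²`. [cite: Balaban1985BackgroundPropagators, (3.23) p.394, (3.3) p.391, (3.8) p.392] -/
theorem equiv_covLaplaceSiteK_flat (c : ℂ) {R S : Bond d Pd → W →ₗ[ℂ] W} (hR : ∀ b w, R b w = w) (hS : ∀ b w, S b w = w)
    (f : SiteL2K ℂ d Pd c₀ W) (x : TSite d Pd) :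
    WL2.equiv ℂ _ W (covLaplaceSiteK c R S f) x =
      (c * c) • ∑ μ, ((WL2.equiv ℂ _ W f x - WL2.equiv ℂ _ W f (unshift μ x)) - (WL2.equiv ℂ _ W f (shift μ x) - WL2.equiv ℂ _ W f x)) := by
  unfold covLaplaceSiteK
  rw [LinearMap.comp_apply, equiv_covDivL2K, covDiv_apply, equiv_covDerivL2K, mul_smul]
  congr 1
  rw [Finset.smul_sum]
  refine Finset.sum_congr rfl fun μ _ => ?_
  rw [covDeriv_apply_dir, covDeriv_apply_dir]
  simp only [hR, hS, shift_unshift, smul_sub]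

end Flat

/-! ## §3 The Laplacian of the section, pointwise -/

section Section

variable {c₀ c₁ : ℝ} [Fact (0 < c₀)] [Fact (0 < c₁)]
  {φ : TSite d (fineP L m) → ℝ}
  (hcross : ∀ b : Bond d (fineP L m), blockCoord L m (btgt b) ≠ blockCoord L m (bpos b) → φ (bpos b) = 0 ∧ φ (btgt b) = 0)
  {Ψ : SiteL2K ℂ d m c₁ W →ₗ[ℂ] SiteL2K ℂ d (fineP L m) c₀ W}
  (hΨ : ∀ (g : SiteL2K ℂ d m c₁ W) (x : TSite d (fineP L m)),
    WL2.equiv ℂ _ W (Ψ g) x = ((φ x : ℝ) : ℂ) • WL2.equiv ℂ _ W g (blockCoord L m x))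
  (c : ℂ) {R S : Bond d (fineP L m) → W →ₗ[ℂ] W} (hR : ∀ b w, R b w = w) (hS : ∀ b w, S b w = w)

include hcross hΨ hR hS

omit [NeZero L] [Fact (0 < c₁)] in
/-- **`(Δ(1)Ψg)(x) = c²·(Σ_μ Δ²_μφ(x))·g(ȳ(x))`** with `Δ²_μφ(x) = (φ(x) − φ(x − e_μ)) − (φ(x + e_μ) − φ(x))` — discrete Leibniz at a block-constant
factor, the face terms killed by §1. [cite: Balaban1985BackgroundPropagators, (3.23) p.394, (3.19) p.393] -/
theorem equiv_covLaplaceSiteK_section (g : SiteL2K ℂ d m c₁ W) (x : TSite d (fineP L m)) :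
    WL2.equiv ℂ _ W (covLaplaceSiteK c R S (Ψ g)) x =
      (c * c * (((∑ μ, ((φ x - φ (unshift μ x)) - (φ (shift μ x) - φ x))) : ℝ) : ℂ)) • WL2.equiv ℂ _ W g (blockCoord L m x) := by
  rw [equiv_covLaplaceSiteK_flat c hR hS]
  conv_rhs => rw [mul_smul, Complex.ofReal_sum, Finset.sum_smul]
  congr 1
  refine Finset.sum_congr rfl fun μ _ => ?_
  rw [hΨ, hΨ, hΨ, smul_apply_shift_eq L m hcross, smul_apply_unshift_eq L m hcross]
  simp only [Complex.ofReal_sub, sub_smul]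

omit [NeZero L] [Fact (0 < c₁)] in
/-- **POINTWISE BOUND**: `‖(Δ(1)Ψg)(x)‖ ≤ ‖c‖²·dℓ₂·‖g(ȳ(x))‖` under the second-difference letter `|Δ²_μφ| ≤ ℓ₂`. [cite: Balaban1985BackgroundPropagators, (3.23) p.394] -/
theorem norm_equiv_covLaplaceSiteK_section_le {ℓ₂ : ℝ}
    (hℓ₂ : ∀ (y : TSite d (fineP L m)) (μ : Fin d), |(φ y - φ (unshift μ y)) - (φ (shift μ y) - φ y)| ≤ ℓ₂)
    (g : SiteL2K ℂ d m c₁ W) (x : TSite d (fineP L m)) :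
    ‖WL2.equiv ℂ _ W (covLaplaceSiteK c R S (Ψ g)) x‖ ≤ ‖c‖ ^ 2 * (d * ℓ₂) * ‖WL2.equiv ℂ _ W g (blockCoord L m x)‖ := by
  rw [equiv_covLaplaceSiteK_section L m hcross hΨ c hR hS, norm_smul, norm_mul, norm_mul, Complex.norm_real, Real.norm_eq_abs, ← sq]
  have hsum : |∑ μ, ((φ x - φ (unshift μ x)) - (φ (shift μ x) - φ x))| ≤ d * ℓ₂ := by
    refine (Finset.abs_sum_le_sum_abs _ _).trans ?_
    calc ∑ μ, |(φ x - φ (unshift μ x)) - (φ (shift μ x) - φ x)| ≤ ∑ _μ : Fin d, ℓ₂ := Finset.sum_le_sum fun μ _ => hℓ₂ x μ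
      _ = d * ℓ₂ := by rw [Finset.sum_const, Finset.card_univ, Fintype.card_fin, nsmul_eq_mul]
  have h0 : 0 ≤ ‖c‖ ^ 2 := sq_nonneg _
  calc ‖c‖ ^ 2 * |∑ μ, ((φ x - φ (unshift μ x)) - (φ (shift μ x) - φ x))| * ‖WL2.equiv ℂ _ W g (blockCoord L m x)‖
      ≤ ‖c‖ ^ 2 * (d * ℓ₂) * ‖WL2.equiv ℂ _ W g (blockCoord L m x)‖ :=
        mul_le_mul_of_nonneg_right (mul_le_mul_of_nonneg_left hsum h0) (norm_nonneg _)

/-! ## §4 The `L²` bound -/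

/-- **`‖Δ(1)(Ψg)‖_{L²(c₀)} ≤ ‖c‖²·dℓ₂·√(c₀L^d∕c₁)·‖g‖_{L²(c₁)}`** — the pointwise bound squared and summed; the blocks partition the fine torus
(`Σ_x ‖g(ȳ(x))‖² = L^d·Σ_y ‖g(y)‖²`). [cite: Balaban1985BackgroundPropagators, (3.23) p.394, (3.19) p.393] -/
theorem norm_covLaplaceSiteK_section_le {ℓ₂ : ℝ} (hℓ0 : 0 ≤ ℓ₂)
    (hℓ₂ : ∀ (y : TSite d (fineP L m)) (μ : Fin d), |(φ y - φ (unshift μ y)) - (φ (shift μ y) - φ y)| ≤ ℓ₂) (g : SiteL2K ℂ d m c₁ W) :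
    ‖covLaplaceSiteK c R S (Ψ g)‖ ≤ ‖c‖ ^ 2 * (d * ℓ₂) * Real.sqrt (c₀ * (L : ℝ) ^ d / c₁) * ‖g‖ := by
  have hc₀ : 0 < c₀ := Fact.out
  have hc₁ : 0 < c₁ := Fact.out
  set K : ℝ := ‖c‖ ^ 2 * (d * ℓ₂) with hK
  have hK0 : 0 ≤ K := by rw [hK]; positivity
  clear_value K
  have hg : ‖g‖ ^ 2 = ∑ y, c₁ * ‖WL2.equiv ℂ _ W g y‖ ^ 2 := WL2.norm_sq (𝕜 := ℂ) (w := fun _ : TSite d m => c₁) (V := W) g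
  have hr : Real.sqrt (c₀ * (L : ℝ) ^ d / c₁) ^ 2 = c₀ * (L : ℝ) ^ d / c₁ := Real.sq_sqrt (by positivity)
  have hpt : ∀ x, ‖WL2.equiv ℂ _ W (covLaplaceSiteK c R S (Ψ g)) x‖ ≤ K * ‖WL2.equiv ℂ _ W g (blockCoord L m x)‖ :=
    fun x => by rw [hK]; exact norm_equiv_covLaplaceSiteK_section_le L m hcross hΨ c hR hS hℓ₂ g x
  have hsq : ‖covLaplaceSiteK c R S (Ψ g)‖ ^ 2 ≤ (K * Real.sqrt (c₀ * (L : ℝ) ^ d / c₁) * ‖g‖) ^ 2 := by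
    rw [WL2.norm_sq (𝕜 := ℂ) (w := fun _ : TSite d (fineP L m) => c₀) (V := W)]
    calc ∑ x, c₀ * ‖WL2.equiv ℂ _ W (covLaplaceSiteK c R S (Ψ g)) x‖ ^ 2
        ≤ ∑ x, c₀ * (K * ‖WL2.equiv ℂ _ W g (blockCoord L m x)‖) ^ 2 :=
          Finset.sum_le_sum fun x _ => mul_le_mul_of_nonneg_left (pow_le_pow_left₀ (norm_nonneg _) (hpt x) 2) hc₀.le
      _ = c₀ * K ^ 2 * ((L : ℝ) ^ d * ∑ y : TSite d m, ‖WL2.equiv ℂ _ W g y‖ ^ 2) := by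
          rw [← sum_norm_sq_comp_blockCoord L m (WL2.equiv ℂ _ W g), Finset.mul_sum]
          exact Finset.sum_congr rfl fun x _ => by ring
      _ = K ^ 2 * (c₀ * (L : ℝ) ^ d / c₁) * ∑ y : TSite d m, c₁ * ‖WL2.equiv ℂ _ W g y‖ ^ 2 := by
          rw [← Finset.mul_sum]; field_simp
      _ = (K * Real.sqrt (c₀ * (L : ℝ) ^ d / c₁) * ‖g‖) ^ 2 := by
          rw [← hg, mul_pow, mul_pow, hr]
  exact (pow_le_pow_iff_left₀ (norm_nonneg _) (by positivity) two_ne_zero).1 hsq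

end Section

/-! ## §5 `Q′(1)Ψ = 1` -/

section RightInverse

variable {𝔸 : Type*} [NormedRing 𝔸] [NormedAlgebra ℂ 𝔸] (φA : W ≃ₗ[ℂ] 𝔸)
  {c₀ c₁ : ℝ}
  {φ : TSite d (fineP L m) → ℝ} (hsum : ∀ y : TSite d m, ∑ x ∈ B9Eq319QprimeTorus.blockOf L m y, ((L : ℝ) ^ d)⁻¹ * φ x = 1)
  {Ψ : SiteL2K ℂ d m c₁ W →ₗ[ℂ] SiteL2K ℂ d (fineP L m) c₀ W}
  (hΨ : ∀ (g : SiteL2K ℂ d m c₁ W) (x : TSite d (fineP L m)),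
    WL2.equiv ℂ _ W (Ψ g) x = ((φ x : ℝ) : ℂ) • WL2.equiv ℂ _ W g (blockCoord L m x))

include hsum hΨ

/-- **`Q′(1)(Ψg) = g`**: the flat block mean of `φ·g(ȳ)` over `B(y)` is `(Σ_{B(y)} L^{−d}φ)·g(y) = g(y)`. [cite: Balaban1985BackgroundPropagators, (3.19) p.393] -/
theorem QprimeW_one_section (g : SiteL2K ℂ d m c₁ W) (y : TSite d m) :
    QprimeW L m φA (fun _ : Bond d (fineP L m) => (1 : 𝔸ˣ)) (c₀ := c₀) (Ψ g) y = WL2.equiv ℂ _ W g y := by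
  rw [QprimeW_one_apply]
  have hx : ∀ x ∈ B9Eq319QprimeTorus.blockOf L m y,
      ((L : ℝ) ^ d)⁻¹ • (WL2.linearEquiv ℂ ℂ (fun _ : TSite d (fineP L m) => c₀) (Ψ g)) x =
        (((((L : ℝ) ^ d)⁻¹ * φ x : ℝ)) : ℂ) • WL2.equiv ℂ _ W g y := by
    intro x hx
    rw [WL2.linearEquiv_apply, hΨ, (mem_blockOf_iff L m y x).1 hx, ← Complex.coe_smul, smul_smul, ← Complex.ofReal_mul]
  rw [Finset.sum_congr rfl hx, ← Finset.sum_smul, ← Complex.ofReal_sum, hsum y, Complex.ofReal_one, one_smul]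

end RightInverse

/-! ## §6 On print's diagonal with the cosine bump's letter: an absolute constant -/

section Diagonal

variable {c₀ c₁ : ℝ} [Fact (0 < c₀)] [Fact (0 < c₁)]
  {φ : TSite d (fineP L m) → ℝ}
  (hcross : ∀ b : Bond d (fineP L m), blockCoord L m (btgt b) ≠ blockCoord L m (bpos b) → φ (bpos b) = 0 ∧ φ (btgt b) = 0)
  (hℓ₂ : ∀ (y : TSite d (fineP L m)) (μ : Fin d), |(φ y - φ (unshift μ y)) - (φ (shift μ y) - φ y)| ≤
    ((L : ℝ) / ((L : ℝ) - 1)) ^ d * ((2 * Real.pi / ((L : ℝ) - 1)) ^ 2 * 2 ^ (d - 1)))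
  {Ψ : SiteL2K ℂ d m c₁ W →ₗ[ℂ] SiteL2K ℂ d (fineP L m) c₀ W}
  (hΨ : ∀ (g : SiteL2K ℂ d m c₁ W) (x : TSite d (fineP L m)),
    WL2.equiv ℂ _ W (Ψ g) x = ((φ x : ℝ) : ℂ) • WL2.equiv ℂ _ W g (blockCoord L m x))
  {η : ℝ} (hLη : (L : ℝ) * η = 1) (hL : 3 ≤ L) (hc : c₀ * (L : ℝ) ^ d = c₁)
  {R S : Bond d (fineP L m) → W →ₗ[ℂ] W} (hR : ∀ b w, R b w = w) (hS : ∀ b w, S b w = w)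

include hcross hℓ₂ hΨ hLη hL hc hR hS

/-- **ON THE DIAGONAL THE LAPLACIAN LETTER IS AN ABSOLUTE CONSTANT**: `c = η⁻¹`, `Lη = 1`, `c₁ = c₀L^d`, `L ≥ 3` and the cosine bump's second-difference
letter give `‖Δ(1)(Ψg)‖ ≤ d(3∕2)^d·9π²·2^{d−1}·‖g‖` — `η`-free, `L`-free, volume-free (`η⁻²·(2π∕(L−1))² ≤ 9π²` at `Lη = 1`).
[cite: Balaban1985BackgroundPropagators, (3.23) p.394, (3.19) p.393, (3.89) p.409] -/
theorem norm_covLaplaceSiteK_section_le_diagonal (g : SiteL2K ℂ d m c₁ W) :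
    ‖covLaplaceSiteK ((η : ℂ))⁻¹ R S (Ψ g)‖ ≤ d * (3 / 2 : ℝ) ^ d * (9 * Real.pi ^ 2) * 2 ^ (d - 1) * ‖g‖ := by
  have hc₀ : 0 < c₀ := Fact.out
  have h3 : (3 : ℝ) ≤ L := by exact_mod_cast hL
  have hL0 : (0 : ℝ) < L := by linarith
  have hL1 : (0 : ℝ) < (L : ℝ) - 1 := by linarith
  have hη : η = (L : ℝ)⁻¹ := by field_simp; linarith
  obtain ⟨hq, hθ, -⟩ := bumpProfileCos_const_le (d := d) L hL
  have hℓ0 : 0 ≤ ((L : ℝ) / ((L : ℝ) - 1)) ^ d * ((2 * Real.pi / ((L : ℝ) - 1)) ^ 2 * 2 ^ (d - 1)) := by positivity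
  have h := norm_covLaplaceSiteK_section_le L m hcross hΨ ((η : ℂ))⁻¹ hR hS hℓ0 hℓ₂ g
  have hnc : ‖((η : ℂ))⁻¹‖ ^ 2 = (L : ℝ) ^ 2 := by
    rw [norm_inv, Complex.norm_real, Real.norm_eq_abs, hη, abs_inv, abs_of_pos hL0, inv_inv]
  have hvol : Real.sqrt (c₀ * (L : ℝ) ^ d / c₁) = 1 := by
    rw [← hc, div_self (by positivity), Real.sqrt_one]
  rw [hnc, hvol, mul_one] at h
  refine h.trans (mul_le_mul_of_nonneg_right ?_ (norm_nonneg _))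
  -- `L²·(L∕(L−1))^d·(2π∕(L−1))²·2^{d−1}·d ≤ d·(3∕2)^d·9π²·2^{d−1}`
  have h1 : ((L : ℝ) / ((L : ℝ) - 1)) ^ d ≤ (3 / 2 : ℝ) ^ d := pow_le_pow_left₀ (by positivity) hq d
  have h2 : (L : ℝ) ^ 2 * (2 * Real.pi / ((L : ℝ) - 1)) ^ 2 ≤ 9 * Real.pi ^ 2 := by
    have e : (L : ℝ) ^ 2 * (2 * Real.pi / ((L : ℝ) - 1)) ^ 2 = ((L : ℝ) * (2 * Real.pi / ((L : ℝ) - 1))) ^ 2 := by ring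
    have h4 : (L : ℝ) * (2 * Real.pi / ((L : ℝ) - 1)) ≤ 3 * Real.pi := by
      calc (L : ℝ) * (2 * Real.pi / ((L : ℝ) - 1)) ≤ (L : ℝ) * (3 * Real.pi / (L : ℝ)) := mul_le_mul_of_nonneg_left hθ hL0.le
        _ = 3 * Real.pi := by field_simp
    have h5 : 0 ≤ (L : ℝ) * (2 * Real.pi / ((L : ℝ) - 1)) := by positivity
    rw [e, show 9 * Real.pi ^ 2 = (3 * Real.pi) ^ 2 by ring]
    exact pow_le_pow_left₀ h5 h4 2
  calc (L : ℝ) ^ 2 * (d * (((L : ℝ) / ((L : ℝ) - 1)) ^ d * ((2 * Real.pi / ((L : ℝ) - 1)) ^ 2 * 2 ^ (d - 1))))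
      = d * ((L : ℝ) / ((L : ℝ) - 1)) ^ d * ((L : ℝ) ^ 2 * (2 * Real.pi / ((L : ℝ) - 1)) ^ 2) * 2 ^ (d - 1) := by ring
    _ ≤ d * (3 / 2 : ℝ) ^ d * (9 * Real.pi ^ 2) * 2 ^ (d - 1) := by gcongr

end Diagonal

/-! ## §7 The package: a linear section of the flat `Q′(1)` with an absolute Laplacian letter -/

section Package

variable {𝔸 : Type*} [NormedRing 𝔸] [NormedAlgebra ℂ 𝔸]
  {c₀ c₁ : ℝ} [Fact (0 < c₀)] [Fact (0 < c₁)]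

/-- **THE FLAT BUMP SECTION WITH ITS LAPLACIAN LETTER**: for `L ≥ 3`, `Lη = 1`, `c₁ = c₀L^d` there is a `ℂ`-linear `Ψ : L²(T_m; c₁) → L²(T_{Lm}; c₀)` —
`(Ψg)(x) = φ(x)·g(ȳ(x))` with the cosine bump `φ` of `B9Eq319BumpProfileCos` — such that `Q′(1)(Ψg) = g` for every fibre reading `φ_A : W ≃ 𝔸`, and for
every pair of identity-acting transporters `‖Δ(1)(Ψg)‖ ≤ d(3∕2)^d·9π²·2^{d−1}·‖g‖`: the `hΨ`∕`hCΨ` letters of `B9Eq387CubeLocalisedProjection.norm_sub_projR_cube_le`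
at the flat background, `η`-free. [cite: Balaban1985BackgroundPropagators, (3.19) p.393, (3.23) p.394, Cor 3.6 p.408, (3.89) p.409] -/
theorem exists_flat_bump_section [∀ i, NeZero (fineP L m i)] (hL : 3 ≤ L) {η : ℝ} (hLη : (L : ℝ) * η = 1) (hc : c₀ * (L : ℝ) ^ d = c₁) :
    ∃ Ψ : SiteL2K ℂ d m c₁ W →ₗ[ℂ] SiteL2K ℂ d (fineP L m) c₀ W,
      (∀ (φA : W ≃ₗ[ℂ] 𝔸) (g : SiteL2K ℂ d m c₁ W) (y : TSite d m),
          QprimeW L m φA (fun _ : Bond d (fineP L m) => (1 : 𝔸ˣ)) (c₀ := c₀) (Ψ g) y = WL2.equiv ℂ _ W g y) ∧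
      (∀ {R S : Bond d (fineP L m) → W →ₗ[ℂ] W}, (∀ b w, R b w = w) → (∀ b w, S b w = w) → ∀ g : SiteL2K ℂ d m c₁ W,
          ‖covLaplaceSiteK ((η : ℂ))⁻¹ R S (Ψ g)‖ ≤ d * (3 / 2 : ℝ) ^ d * (9 * Real.pi ^ 2) * 2 ^ (d - 1) * ‖g‖) := by
  obtain ⟨φ, hsum, -, -, -, hcross, hℓ₂⟩ := exists_bumpProfileCos (d := d) L m hL
  -- the section as a `LinearMap.pi` of scaled evaluations at the block coordinate, read on the `L²` synonyms
  let E : (TSite d m → W) →ₗ[ℂ] (TSite d (fineP L m) → W) :=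
    LinearMap.pi fun x : TSite d (fineP L m) => ((φ x : ℝ) : ℂ) • LinearMap.proj (R := ℂ) (φ := fun _ : TSite d m => W) (blockCoord L m x)
  let Ψ : SiteL2K ℂ d m c₁ W →ₗ[ℂ] SiteL2K ℂ d (fineP L m) c₀ W :=
    (WL2.linearEquiv ℂ ℂ (fun _ : TSite d (fineP L m) => c₀)).symm.toLinearMap ∘ₗ E ∘ₗ
      (WL2.linearEquiv ℂ ℂ (fun _ : TSite d m => c₁)).toLinearMap
  have hΨ : ∀ (g : SiteL2K ℂ d m c₁ W) (x : TSite d (fineP L m)),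
      WL2.equiv ℂ _ W (Ψ g) x = ((φ x : ℝ) : ℂ) • WL2.equiv ℂ _ W g (blockCoord L m x) := fun g x => rfl
  refine ⟨Ψ, fun φA g y => QprimeW_one_section L m φA hsum hΨ g y, fun hR hS g => ?_⟩
  exact norm_covLaplaceSiteK_section_le_diagonal L m hcross hℓ₂ hΨ hLη hL hc hR hS g

end Package

end Literature.MathematicalPhysics.QuantumFieldTheory.Balaban1983to89.B9Eq319BumpSectionLaplacianFlat

end
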